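import Literature.Geometry.Riemannian.ColdingMinicozziEntropyInvariance
import Literature.Geometry.Riemannian.ColdingMinicozziEntropyFinite
import Literature.Geometry.Riemannian.GaussianAreaDistortion
import HarnessLib

/-!
# The Colding–Minicozzi entropy of a `C¹` submanifold germ is at least one

Companion of `ColdingMinicozziEntropyFinite.lean` (finiteness, Colding–Minicozzi 2012, Lemma 7.2
(4)). Here we prove the lower half of Lemma 7.2 (3) — "for each `x₀`, `lim_{t₀ → 0} F_{x₀,t₀}(Σ)`
is `1` if `x₀ ∈ Σ`" whose "standard" proof is that "smooth hypersurfaces are approximated by a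
hyperplane on small scales (the function `(4πt₀)^{-n/2} e^{-|x-x₀|²/4t₀}` is a heat kernel on a
hyperplane through `x₀` and has integral one on the hyperplane independent of `t₀`)" — in the
form of the entropy bound it implies:

* `exists_biLipschitz_tangent_reparam` — the local picture: a `C¹` germ `g` at `u₀` with
  injective differential is, after reparametrisation by its tangent space `T`, a
  `(1 ± ε)`-bi-Lipschitz map `h : ball 0 r ⊆ T → F` with `h 0 = g u₀`, image inside `g(U)` and
  containing `g(N)` for a neighbourhood `N` of `u₀`;
* `one_le_mul_gaussianArea_image_add` — pointwise in the scale: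
  `1 ≤ ((1+ε)/(1-ε))ⁿ F_{g u₀, t(1+ε)²}(g(U)) + 2^{n/2} e^{-r²/8t}` for all `t > 0`;
* `one_le_gaussianEntropy_image_of_hasStrictFDerivAt` — if `g : E → F` (`dim E = n`, `F` a
  real inner product space) is strictly differentiable at `u₀` with injective differential,
  then `1 ≤ λ(g(U))` for every neighbourhood `U` of `u₀`;
* `one_le_gaussianEntropy_range` — hence `1 ≤ λ(f(M))` for a map `f` from a manifold
  (boundaryless model on an `n`-dimensional space) into `F` which is `C¹` with injective
  differential at one point; with `ColdingMinicozziEntropyFinite.lean`,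
  `1 ≤ λ(ι(M)) < ∞` for every closed immersed submanifold.

## Proof

Reparametrise by the tangent space: `T = range dg(u₀) ≤ F` carries the induced inner product,
`e : E ≅ T`, and `h(v) = g(u₀ + e⁻¹ v)` has `dh(0) =` the inclusion `T ⊆ F`, so for `ε > 0` it
is `(1+ε)`-Lipschitz and `(1-ε)`-co-Lipschitz on a small ball `B_r ⊆ T`
(`exists_nhds_norm_sub_sub_le_of_hasStrictFDerivAt`). Then, for every `t > 0`,

* `gaussianArea_image_ge` — **distortion comparison**:
  `F_{h(0), t}(h(B_r)) ≥ ((1-ε)/(1+ε))ⁿ · F_{0, t/(1+ε)²}(B_r)` (the latter in `T`): by the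
  layer-cake formula on both sides (`lintegral_gaussianWeight_image_ge`), the super-level sets
  of the weights being balls (`setOf_lt_gaussian_eq_ball`), `h(B_r ∩ B_{R/(1+ε)}) ⊆ B(h 0, R)`
  by the Lipschitz bound, and `𝓗ⁿ(h(S)) ≥ (1-ε)ⁿ 𝓗ⁿ(S)` by the co-Lipschitz bound
  (`hausdorffMeasure_le_mul_image_of_coLipschitz`: the inverse of `h` on `h(S)` is
  `(1-ε)⁻¹`-Lipschitz, and Lipschitz maps increase `𝓗ⁿ` by at most the `n`-th power of the
  constant, Federer 2.10.11);
* `one_le_gaussianArea_ball_add` — **flat computation**: in the `n`-dimensional inner product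
  space `T`, `1 ≤ F_{0,t}(B_r) + 2^{n/2} e^{-r²/8t}`, from `F_{0,t}(T) = 1`
  (`gaussianArea_zero_univ`, the Gaussian integral of `ColdingMinicozziEntropyInvariance.lean`)
  and the tail bound `∫_{T ∖ B_r} e^{-|v|²/4t} ≤ e^{-r²/8t} ∫_T e^{-|v|²/8t}`;

so `1 ≤ ((1+ε)/(1-ε))ⁿ λ(g(U)) + 2^{n/2} e^{-r²/8t'}` for all `t' > 0`; let `t' → 0`, then
`ε → 0`.

Everything is proved; no definitions and no named facts are introduced.

## References

* T. H. Colding, W. P. Minicozzi II, *Generic mean curvature flow I; generic singularities*,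
  Ann. of Math. 175 (2012) 755–833, Lemma 7.2 (3) and its proof. [ColdingMinicozzi2012]
* H. Federer, *Geometric Measure Theory* (1969), 2.10.11. [Federer1969]
-/

noncomputable section

open Set Function Filter Module Metric
open _root_.MeasureTheory _root_.MeasureTheory.Measure
open scoped ENNReal NNReal Topology Manifold

namespace Literature.Geometry.Riemannian

/-! ### Flat computations in an `n`-dimensional inner product space -/

section Flat

variable {V : Type*} [NormedAddCommGroup V] [InnerProductSpace ℝ V] [FiniteDimensional ℝ V]
  [MeasurableSpace V] [BorelSpace V]

/-- `∫_V e^{-‖v‖²/4t} dμHE[n] = (4πt)^{n/2}` on an `n`-dimensional inner product space `V`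
(`μHE[n] = volume` there; `lintegral_gaussianWeight_zero`). [folklore] -/
theorem lintegral_gaussianWeight_zero_euclideanHausdorff {n : ℕ} (hV : finrank ℝ V = n) {t : ℝ}
    (ht : 0 < t) :
    ∫⁻ v, gaussianWeight (0 : V) t v ∂(μHE[n] : Measure V) =
      ENNReal.ofReal ((4 * Real.pi * t) ^ ((n : ℝ) / 2)) := by
  subst hV
  rw [InnerProductSpace.euclideanHausdorffMeasure_eq_volume]
  exact lintegral_gaussianWeight_zero ht

/-- **An `n`-dimensional inner product space has Gaussian area `1` from the origin at every
scale**: `F_{0,t}(V) = 1` (Colding–Minicozzi 2012, Remark 1.7; cf.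
`gaussianArea_affineSubspace_of_mem`). [cite: ColdingMinicozzi2012, Remark 1.7] -/
theorem gaussianArea_zero_univ {n : ℕ} (hV : finrank ℝ V = n) {t : ℝ} (ht : 0 < t) :
    gaussianArea n (0 : V) t (univ : Set V) = 1 := by
  rw [gaussianArea_eq, Measure.restrict_univ, lintegral_gaussianWeight_zero_euclideanHausdorff hV ht,
    gaussianNormalization, ← ENNReal.ofReal_mul (Real.rpow_nonneg (by positivity) _),
    ← Real.rpow_add (by positivity),
    show -(n : ℝ) / 2 + (n : ℝ) / 2 = 0 by ring, Real.rpow_zero, ENNReal.ofReal_one]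

/-- Subadditivity of the Gaussian area: `F_{p,t}(A ∪ B) ≤ F_{p,t}(A) + F_{p,t}(B)`. [folklore] -/
theorem gaussianArea_union_le {E : Type*} [NormedAddCommGroup E] [MeasurableSpace E] [BorelSpace E]
    (n : ℕ) (p : E) (t : ℝ) (A B : Set E) :
    gaussianArea n p t (A ∪ B) ≤ gaussianArea n p t A + gaussianArea n p t B := by
  rw [gaussianArea_eq, gaussianArea_eq, gaussianArea_eq, ← mul_add, ← lintegral_add_measure]
  gcongr
  exact Measure.restrict_union_le A B

/-- **Gaussian tail outside a ball**: `∫_{V ∖ B_r} e^{-‖v‖²/4t} dμHE[n] ≤ e^{-r²/8t} (8πt)^{n/2}`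
(`e^{-‖v‖²/4t} ≤ e^{-r²/8t} e^{-‖v‖²/8t}` for `‖v‖ ≥ r`, and `∫_V e^{-‖v‖²/8t} = (8πt)^{n/2}`).
[folklore] -/
theorem lintegral_gaussianWeight_compl_ball_le {n : ℕ} (hV : finrank ℝ V = n) {t : ℝ} (ht : 0 < t)
    {r : ℝ} (hr : 0 ≤ r) :
    ∫⁻ v in (ball (0 : V) r)ᶜ, gaussianWeight (0 : V) t v ∂(μHE[n] : Measure V) ≤
      ENNReal.ofReal (Real.exp (-r ^ 2 / (8 * t))) *
        ENNReal.ofReal ((8 * Real.pi * t) ^ ((n : ℝ) / 2)) := by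
  have h8 : (0 : ℝ) < 8 * t := by positivity
  have hpt : ∀ v ∈ (ball (0 : V) r)ᶜ, gaussianWeight (0 : V) t v ≤
      ENNReal.ofReal (Real.exp (-r ^ 2 / (8 * t))) * gaussianWeight (0 : V) (2 * t) v := by
    intro v hv
    rw [mem_compl_iff, mem_ball_zero_iff, not_lt] at hv
    simp only [gaussianWeight, sub_zero]
    rw [← ENNReal.ofReal_mul (Real.exp_pos _).le, ← Real.exp_add]
    apply ENNReal.ofReal_le_ofReal
    apply Real.exp_le_exp.2
    have hsq : r ^ 2 ≤ ‖v‖ ^ 2 := pow_le_pow_left₀ hr hv 2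
    have h1 : -‖v‖ ^ 2 / (4 * t) = (-‖v‖ ^ 2 + -‖v‖ ^ 2) / (8 * t) := by
      field_simp
      ring
    rw [h1, show 4 * (2 * t) = 8 * t by ring, ← add_div]
    exact div_le_div_of_nonneg_right (by linarith) h8.le
  calc ∫⁻ v in (ball (0 : V) r)ᶜ, gaussianWeight (0 : V) t v ∂(μHE[n] : Measure V)
      ≤ ∫⁻ v in (ball (0 : V) r)ᶜ, ENNReal.ofReal (Real.exp (-r ^ 2 / (8 * t))) *
          gaussianWeight (0 : V) (2 * t) v ∂(μHE[n] : Measure V) :=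
        setLIntegral_mono' isOpen_ball.measurableSet.compl hpt
    _ ≤ ∫⁻ v, ENNReal.ofReal (Real.exp (-r ^ 2 / (8 * t))) *
          gaussianWeight (0 : V) (2 * t) v ∂(μHE[n] : Measure V) := setLIntegral_le_lintegral _ _
    _ = ENNReal.ofReal (Real.exp (-r ^ 2 / (8 * t))) *
          ENNReal.ofReal ((8 * Real.pi * t) ^ ((n : ℝ) / 2)) := by
        rw [lintegral_const_mul _ (measurable_gaussianWeight _ _),
          lintegral_gaussianWeight_zero_euclideanHausdorff hV (by positivity : (0 : ℝ) < 2 * t),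
          show 4 * Real.pi * (2 * t) = 8 * Real.pi * t by ring]

/-- **A ball of an `n`-plane has Gaussian area almost `1` at small scales**:
`1 ≤ F_{0,t}(B_r) + 2^{n/2} e^{-r²/8t}` in an `n`-dimensional inner product space (`r ≥ 0`,
`t > 0`), from `F_{0,t}(V) = 1`, subadditivity and the tail bound — the quantitative form of
"the heat kernel has integral one on the hyperplane independent of `t₀`" (Colding–Minicozzi
2012, proof of Lemma 7.2 (3)). [cite: ColdingMinicozzi2012, Lemma 7.2] -/
theorem one_le_gaussianArea_ball_add {n : ℕ} (hV : finrank ℝ V = n) {t : ℝ} (ht : 0 < t)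
    {r : ℝ} (hr : 0 ≤ r) :
    1 ≤ gaussianArea n (0 : V) t (ball 0 r) +
      ENNReal.ofReal ((2 : ℝ) ^ ((n : ℝ) / 2) * Real.exp (-r ^ 2 / (8 * t))) := by
  have htail : gaussianArea n (0 : V) t (ball 0 r)ᶜ ≤
      ENNReal.ofReal ((2 : ℝ) ^ ((n : ℝ) / 2) * Real.exp (-r ^ 2 / (8 * t))) := by
    rw [gaussianArea_eq, gaussianNormalization]
    refine (mul_le_mul' le_rfl (lintegral_gaussianWeight_compl_ball_le hV ht hr)).trans (le_of_eq ?_)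
    rw [← ENNReal.ofReal_mul (Real.exp_pos _).le,
      ← ENNReal.ofReal_mul (Real.rpow_nonneg (by positivity) _)]
    congr 1
    have hkey : (4 * Real.pi * t) ^ (-(n : ℝ) / 2) * (8 * Real.pi * t) ^ ((n : ℝ) / 2) =
        (2 : ℝ) ^ ((n : ℝ) / 2) := by
      rw [show 8 * Real.pi * t = 2 * (4 * Real.pi * t) by ring,
        Real.mul_rpow (x := (2 : ℝ)) (y := 4 * Real.pi * t) (by norm_num) (by positivity),
        mul_left_comm, ← Real.rpow_add (by positivity : (0 : ℝ) < 4 * Real.pi * t),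
        show -(n : ℝ) / 2 + (n : ℝ) / 2 = 0 by ring, Real.rpow_zero, mul_one]
    calc (4 * Real.pi * t) ^ (-(n : ℝ) / 2) *
          (Real.exp (-r ^ 2 / (8 * t)) * (8 * Real.pi * t) ^ ((n : ℝ) / 2))
        = ((4 * Real.pi * t) ^ (-(n : ℝ) / 2) * (8 * Real.pi * t) ^ ((n : ℝ) / 2)) *
            Real.exp (-r ^ 2 / (8 * t)) := by ring
      _ = (2 : ℝ) ^ ((n : ℝ) / 2) * Real.exp (-r ^ 2 / (8 * t)) := by rw [hkey]
  calc (1 : ℝ≥0∞) = gaussianArea n (0 : V) t univ := (gaussianArea_zero_univ hV ht).symm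
    _ = gaussianArea n (0 : V) t (ball 0 r ∪ (ball 0 r)ᶜ) := by rw [union_compl_self]
    _ ≤ gaussianArea n (0 : V) t (ball 0 r) + gaussianArea n (0 : V) t (ball 0 r)ᶜ :=
        gaussianArea_union_le _ _ _ _ _
    _ ≤ gaussianArea n (0 : V) t (ball 0 r) +
        ENNReal.ofReal ((2 : ℝ) ^ ((n : ℝ) / 2) * Real.exp (-r ^ 2 / (8 * t))) :=
        add_le_add (le_refl _) htail

end Flat

/-! ### The lower bound `1 ≤ λ` -/

section LowerBound

variable {EM : Type*} [NormedAddCommGroup EM] [NormedSpace ℝ EM] [FiniteDimensional ℝ EM]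
  {F : Type*} [NormedAddCommGroup F] [InnerProductSpace ℝ F] [MeasurableSpace F] [BorelSpace F]

/-- The flat error term `2^{n/2} e^{-r²/8t}` is small for small `t > 0` (`r > 0`). [folklore] -/
theorem exists_pos_errTerm_le (n : ℕ) {r : ℝ} (hr : 0 < r) {δ : ℝ} (hδ : 0 < δ) :
    ∃ t : ℝ, 0 < t ∧ (2 : ℝ) ^ ((n : ℝ) / 2) * Real.exp (-r ^ 2 / (8 * t)) < δ := by
  have h1 : Tendsto (fun t : ℝ => r ^ 2 / 8 * t⁻¹) (𝓝[>] 0) atTop :=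
    tendsto_inv_nhdsGT_zero.const_mul_atTop (by positivity)
  have h2 : Tendsto (fun t : ℝ => Real.exp (-(r ^ 2 / 8 * t⁻¹))) (𝓝[>] 0) (𝓝 0) :=
    Real.tendsto_exp_neg_atTop_nhds_zero.comp h1
  have h3 : Tendsto (fun t : ℝ => (2 : ℝ) ^ ((n : ℝ) / 2) * Real.exp (-(r ^ 2 / 8 * t⁻¹)))
      (𝓝[>] 0) (𝓝 ((2 : ℝ) ^ ((n : ℝ) / 2) * 0)) := h2.const_mul _
  rw [mul_zero] at h3
  have h4 : ∀ᶠ t : ℝ in 𝓝[>] 0, (2 : ℝ) ^ ((n : ℝ) / 2) * Real.exp (-(r ^ 2 / 8 * t⁻¹)) < δ :=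
    (tendsto_order.1 h3).2 δ hδ
  obtain ⟨t, ht, htpos⟩ := (h4.and self_mem_nhdsWithin).exists
  refine ⟨t, htpos, ?_⟩
  have : -r ^ 2 / (8 * t) = -(r ^ 2 / 8 * t⁻¹) := by
    field_simp
  rw [this]
  exact ht

omit [MeasurableSpace F] [BorelSpace F] in
/-- **Bi-Lipschitz reparametrisation of a `C¹` germ by its tangent space.** Let `g : E → F`
(`dim E = n`, `F` a real inner product space) be strictly differentiable at `u₀` with injective
differential `A`, `U` a neighbourhood of `u₀` and `ε > 0`. With `T = range A ≤ F` (an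
`n`-dimensional subspace, carrying the induced inner product) and `e : E ≅ T` the corestriction
of `A`, the map `h(v) = g(u₀ + e⁻¹ v)` satisfies `h 0 = g u₀`, has derivative the inclusion
`T ⊆ F` at `0`, hence (`exists_nhds_norm_sub_sub_le_of_hasStrictFDerivAt`) is `(1+ε)`-Lipschitz
and `(1-ε)`-co-Lipschitz on a small ball `ball 0 r`, whose image lies in `g(U)` and contains
`g(N)` for a neighbourhood `N` of `u₀`. (The local picture "a `C¹` submanifold is a small
bi-Lipschitz distortion of its tangent plane" behind Colding–Minicozzi 2012, Lemma 7.2 (3).)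
[cite: ColdingMinicozzi2012, Lemma 7.2] -/
theorem exists_biLipschitz_tangent_reparam {n : ℕ} (hn : finrank ℝ EM = n)
    {g : EM → F} {A : EM →L[ℝ] F} {u₀ : EM} (hg : HasStrictFDerivAt g A u₀) (hA : Injective A)
    {U : Set EM} (hU : U ∈ 𝓝 u₀) {ε : ℝ} (hε : 0 < ε) :
    ∃ (T : Submodule ℝ F) (_ : FiniteDimensional ℝ T) (h : T → F) (r : ℝ),
      finrank ℝ T = n ∧ 0 < r ∧ h 0 = g u₀ ∧
      (∀ v ∈ ball (0 : T) r, ∀ w ∈ ball (0 : T) r, ‖h v - h w‖ ≤ (1 + ε) * ‖v - w‖) ∧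
      (∀ v ∈ ball (0 : T) r, ∀ w ∈ ball (0 : T) r, (1 - ε) * ‖v - w‖ ≤ ‖h v - h w‖) ∧
      h '' ball (0 : T) r ⊆ g '' U ∧ ∃ N ∈ 𝓝 u₀, g '' N ⊆ h '' ball (0 : T) r := by
  -- the tangent space `T = range A` and the isomorphism `e : EM ≃ T`
  set T : Submodule ℝ F := LinearMap.range (A : EM →ₗ[ℝ] F) with hT
  set e : EM ≃L[ℝ] T := (LinearEquiv.ofInjective (A : EM →ₗ[ℝ] F) hA).toContinuousLinearEquiv
    with he
  have hTn : finrank ℝ T = n := by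
    rw [← hn]
    exact LinearMap.finrank_range_of_inj hA
  have heA : ∀ v : T, (A (e.symm v) : F) = (v : F) := by
    intro v
    have h1 : ((LinearEquiv.ofInjective (A : EM →ₗ[ℝ] F) hA (e.symm v) : T) : F) = A (e.symm v) :=
      LinearEquiv.ofInjective_apply (f := (A : EM →ₗ[ℝ] F)) (h := hA) (e.symm v)
    rw [← h1]
    exact congrArg Subtype.val (e.apply_symm_apply v)
  -- the reparametrisation `hmap v = g (u₀ + e⁻¹ v)` has derivative the inclusion `T ⊆ F` at `0`
  set hmap : T → F := fun v => g (u₀ + e.symm v) with hh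
  have h0 : hmap 0 = g u₀ := by simp [hh]
  have hderiv : HasStrictFDerivAt hmap T.subtypeL 0 := by
    have h1 : HasStrictFDerivAt (fun v : T => u₀ + e.symm v) (e.symm : T →L[ℝ] EM) 0 :=
      ((e.symm : T →L[ℝ] EM).hasStrictFDerivAt).const_add u₀
    have h2 : HasStrictFDerivAt g A (u₀ + e.symm 0) := by simpa using hg
    have h3 := h2.comp (0 : T) h1
    have hAe : A.comp (e.symm : T →L[ℝ] EM) = T.subtypeL := by
      ext v
      exact heA v
    rw [hAe] at h3
    exact h3
  obtain ⟨W, hW, hWb⟩ := exists_nhds_norm_sub_sub_le_of_hasStrictFDerivAt hderiv hε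
  have hcont : Continuous fun v : T => u₀ + e.symm v := by fun_prop
  have hpre : (fun v : T => u₀ + e.symm v) ⁻¹' U ∈ 𝓝 (0 : T) :=
    hcont.continuousAt.preimage_mem_nhds (by simpa using hU)
  obtain ⟨r, hr, hball⟩ := Metric.mem_nhds_iff.1 (inter_mem hW hpre)
  have hnormL : ∀ v w : T, ‖T.subtypeL (v - w)‖ = ‖v - w‖ := fun v w => by
    rw [Submodule.subtypeL_apply, Submodule.coe_norm]
  refine ⟨T, inferInstance, hmap, r, hTn, hr, h0, ?_, ?_, ?_, ?_⟩
  · intro v hv w hw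
    have h1 := hWb v (hball hv).1 w (hball hw).1
    calc ‖hmap v - hmap w‖
        = ‖(hmap v - hmap w - T.subtypeL (v - w)) + T.subtypeL (v - w)‖ := by rw [sub_add_cancel]
      _ ≤ ‖hmap v - hmap w - T.subtypeL (v - w)‖ + ‖T.subtypeL (v - w)‖ := norm_add_le _ _
      _ ≤ ε * ‖v - w‖ + ‖v - w‖ := add_le_add h1 (hnormL v w).le
      _ = (1 + ε) * ‖v - w‖ := by ring
  · intro v hv w hw
    have h1 := hWb v (hball hv).1 w (hball hw).1
    have h2 : ‖T.subtypeL (v - w)‖ - ‖hmap v - hmap w‖ ≤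
        ‖hmap v - hmap w - T.subtypeL (v - w)‖ := by
      rw [← norm_neg (hmap v - hmap w - T.subtypeL (v - w)), neg_sub]
      exact norm_sub_norm_le _ _
    rw [hnormL v w] at h2
    linarith
  · rintro _ ⟨v, hv, rfl⟩
    exact ⟨_, (hball hv).2, rfl⟩
  · -- `N = {u | e (u - u₀) ∈ ball 0 r}` is a neighbourhood of `u₀` with `g(N) ⊆ hmap(ball 0 r)`
    have hcont' : Continuous fun u : EM => e (u - u₀) := by fun_prop
    refine ⟨(fun u : EM => e (u - u₀)) ⁻¹' ball (0 : T) r,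
      hcont'.continuousAt.preimage_mem_nhds (by simpa using ball_mem_nhds (0 : T) hr), ?_⟩
    rintro _ ⟨u, hu, rfl⟩
    refine ⟨e (u - u₀), hu, ?_⟩
    simp only [hh, ContinuousLinearEquiv.symm_apply_apply, add_sub_cancel]

/-- **Pointwise form: a `C¹` germ has Gaussian area almost `1` at small scales.** Let
`g : E → F` (`dim E = n`, `F` a real inner product space) be strictly differentiable at `u₀`
with injective differential, `U` a neighbourhood of `u₀` and `0 < ε < 1`. Then there is `r > 0`
such that for every `t > 0`
`1 ≤ ((1+ε)/(1-ε))ⁿ · F_{g u₀, t(1+ε)²}(g(U)) + 2^{n/2} e^{-r²/8t}`: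
with the bi-Lipschitz tangent reparametrisation `h` of `exists_biLipschitz_tangent_reparam`,
`1 ≤ F^T_{0,t}(B_r) + 2^{n/2}e^{-r²/8t}` (`one_le_gaussianArea_ball_add`) and
`((1-ε)/(1+ε))ⁿ F^T_{0,t}(B_r) ≤ F_{h 0, t(1+ε)²}(h(B_r)) ≤ F_{g u₀, t(1+ε)²}(g(U))`
(`gaussianArea_image_ge`). This is the lower half of Colding–Minicozzi 2012, Lemma 7.2 (3)
("`lim_{t₀→0} F_{x₀,t₀}(Σ) = 1` if `x₀ ∈ Σ`"), quantitatively. [cite: ColdingMinicozzi2012, Lemma 7.2] -/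
theorem one_le_mul_gaussianArea_image_add {n : ℕ} (hn : finrank ℝ EM = n)
    {g : EM → F} {A : EM →L[ℝ] F} {u₀ : EM} (hg : HasStrictFDerivAt g A u₀) (hA : Injective A)
    {U : Set EM} (hU : U ∈ 𝓝 u₀) {ε : ℝ} (hε : 0 < ε) (hε1 : ε < 1) :
    ∃ r : ℝ, 0 < r ∧ ∀ t : ℝ, 0 < t →
      (1 : ℝ≥0∞) ≤ ENNReal.ofReal (((1 + ε) / (1 - ε)) ^ n) *
          gaussianArea n (g u₀) (t * (1 + ε) ^ 2) (g '' U) +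
        ENNReal.ofReal ((2 : ℝ) ^ ((n : ℝ) / 2) * Real.exp (-r ^ 2 / (8 * t))) := by
  obtain ⟨T, hTfd, h, r, hTn, hr, h0, hlip, hco, himg, -⟩ :=
    exists_biLipschitz_tangent_reparam hn hg hA hU hε
  haveI := hTfd
  have ha : 0 < 1 + ε := by linarith
  have hKK : ENNReal.ofReal (((1 + ε) / (1 - ε)) ^ n) *
      ENNReal.ofReal (((1 - ε) / (1 + ε)) ^ n) = 1 := by
    rw [← ENNReal.ofReal_mul (by positivity), ← mul_pow, div_mul_div_comm, mul_comm (1 + ε),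
      div_self (by positivity : (1 - ε) * (1 + ε) ≠ 0), one_pow, ENNReal.ofReal_one]
  refine ⟨r, hr, fun t ht => ?_⟩
  have hflat := one_le_gaussianArea_ball_add hTn ht hr.le
  have hdist := gaussianArea_image_ge (n := n) hε hε1 hr hlip hco
    (t := t * (1 + ε) ^ 2) (by positivity)
  have ht_eq : t * (1 + ε) ^ 2 / (1 + ε) ^ 2 = t := by field_simp
  rw [ht_eq, h0] at hdist
  have hmono : gaussianArea n (g u₀) (t * (1 + ε) ^ 2) (h '' ball (0 : T) r) ≤
      gaussianArea n (g u₀) (t * (1 + ε) ^ 2) (g '' U) := gaussianArea_mono _ _ _ himg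
  calc (1 : ℝ≥0∞)
      ≤ gaussianArea n (0 : T) t (ball 0 r) +
        ENNReal.ofReal ((2 : ℝ) ^ ((n : ℝ) / 2) * Real.exp (-r ^ 2 / (8 * t))) := hflat
    _ = ENNReal.ofReal (((1 + ε) / (1 - ε)) ^ n) *
          (ENNReal.ofReal (((1 - ε) / (1 + ε)) ^ n) * gaussianArea n (0 : T) t (ball 0 r)) +
        ENNReal.ofReal ((2 : ℝ) ^ ((n : ℝ) / 2) * Real.exp (-r ^ 2 / (8 * t))) := by
        rw [← mul_assoc, hKK, one_mul]
    _ ≤ ENNReal.ofReal (((1 + ε) / (1 - ε)) ^ n) *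
          gaussianArea n (g u₀) (t * (1 + ε) ^ 2) (h '' ball (0 : T) r) +
        ENNReal.ofReal ((2 : ℝ) ^ ((n : ℝ) / 2) * Real.exp (-r ^ 2 / (8 * t))) :=
        add_le_add (mul_le_mul' le_rfl hdist) le_rfl
    _ ≤ ENNReal.ofReal (((1 + ε) / (1 - ε)) ^ n) *
          gaussianArea n (g u₀) (t * (1 + ε) ^ 2) (g '' U) +
        ENNReal.ofReal ((2 : ℝ) ^ ((n : ℝ) / 2) * Real.exp (-r ^ 2 / (8 * t))) :=
        add_le_add (mul_le_mul' le_rfl hmono) le_rfl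

/-- **The entropy of a `C¹` `n`-dimensional germ is at least `1`.** If `g : E → F` (`E` of
dimension `n`, `F` a real inner product space) is strictly differentiable at `u₀` with injective
differential, then `1 ≤ λ(g(U)) = gaussianEntropy n (g '' U)` for every neighbourhood `U` of
`u₀`: by `one_le_mul_gaussianArea_image_add`, `1 ≤ ((1+ε)/(1-ε))ⁿ λ(g(U)) + 2^{n/2}e^{-r²/8t}`
for all `t > 0`; let `t → 0` (`exists_pos_errTerm_le`), then `ε → 0`. The lower half of
Colding–Minicozzi 2012, Lemma 7.2 (3), in entropy form. [cite: ColdingMinicozzi2012, Lemma 7.2] -/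
theorem one_le_gaussianEntropy_image_of_hasStrictFDerivAt {n : ℕ} (hn : finrank ℝ EM = n)
    {g : EM → F} {A : EM →L[ℝ] F} {u₀ : EM} (hg : HasStrictFDerivAt g A u₀) (hA : Injective A)
    {U : Set EM} (hU : U ∈ 𝓝 u₀) : 1 ≤ gaussianEntropy n (g '' U) := by
  -- Step 1: for every `ε ∈ (0, 1)`, `1 ≤ ((1+ε)/(1-ε))ⁿ · λ(g(U))`
  have main : ∀ ε : ℝ, 0 < ε → ε < 1 →
      (1 : ℝ≥0∞) ≤ ENNReal.ofReal (((1 + ε) / (1 - ε)) ^ n) * gaussianEntropy n (g '' U) := by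
    intro ε hε hε1
    have ha : 0 < 1 + ε := by linarith
    obtain ⟨r, hr, hpt⟩ := one_le_mul_gaussianArea_image_add hn hg hA hU hε hε1
    refine ENNReal.le_of_forall_pos_le_add fun δ hδ _ => ?_
    obtain ⟨t, ht, herr⟩ := exists_pos_errTerm_le n hr (δ := (δ : ℝ)) (by exact_mod_cast hδ)
    have herr' : ENNReal.ofReal ((2 : ℝ) ^ ((n : ℝ) / 2) * Real.exp (-r ^ 2 / (8 * t))) ≤
        (δ : ℝ≥0∞) := by
      rw [← ENNReal.ofReal_coe_nnreal]
      exact ENNReal.ofReal_le_ofReal herr.le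
    have hent : gaussianArea n (g u₀) (t * (1 + ε) ^ 2) (g '' U) ≤ gaussianEntropy n (g '' U) :=
      gaussianArea_le_gaussianEntropy _ _ (by positivity) _
    calc (1 : ℝ≥0∞)
        ≤ ENNReal.ofReal (((1 + ε) / (1 - ε)) ^ n) *
            gaussianArea n (g u₀) (t * (1 + ε) ^ 2) (g '' U) +
          ENNReal.ofReal ((2 : ℝ) ^ ((n : ℝ) / 2) * Real.exp (-r ^ 2 / (8 * t))) := hpt t ht
      _ ≤ ENNReal.ofReal (((1 + ε) / (1 - ε)) ^ n) * gaussianEntropy n (g '' U) + (δ : ℝ≥0∞) :=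
          add_le_add (mul_le_mul' le_rfl hent) herr'
  -- Step 2: let `ε → 0`
  by_cases htop : gaussianEntropy n (g '' U) = ∞
  · rw [htop]
    exact le_top
  · set L : ℝ := (gaussianEntropy n (g '' U)).toReal with hL
    have hLreal : ∀ ε, 0 < ε → ε < 1 → (1 : ℝ) ≤ ((1 + ε) / (1 - ε)) ^ n * L := by
      intro ε hε hε1
      have h := main ε hε hε1
      have h' : ENNReal.ofReal (((1 + ε) / (1 - ε)) ^ n) * gaussianEntropy n (g '' U) =
          ENNReal.ofReal (((1 + ε) / (1 - ε)) ^ n * L) := by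
        rw [ENNReal.ofReal_mul (by positivity), hL, ENNReal.ofReal_toReal htop]
      rw [h'] at h
      have h1 := ENNReal.toReal_mono ENNReal.ofReal_ne_top h
      rwa [ENNReal.toReal_one, ENNReal.toReal_ofReal (by positivity)] at h1
    have hlim : Tendsto (fun ε : ℝ => ((1 + ε) / (1 - ε)) ^ n * L) (𝓝[>] 0) (𝓝 L) := by
      have hcts : ContinuousAt (fun ε : ℝ => ((1 + ε) / (1 - ε)) ^ n * L) 0 := by
        refine ContinuousAt.mul (ContinuousAt.pow (ContinuousAt.div (by fun_prop) (by fun_prop)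
          (by norm_num)) n) continuousAt_const
      have := hcts.tendsto
      simp only [add_zero, sub_zero, div_one, one_pow, one_mul] at this
      exact this.mono_left nhdsWithin_le_nhds
    have hev : ∀ᶠ ε : ℝ in 𝓝[>] 0, (1 : ℝ) ≤ ((1 + ε) / (1 - ε)) ^ n * L := by
      have h1 : ∀ᶠ ε : ℝ in 𝓝[>] 0, ε < 1 :=
        mem_nhdsWithin_of_mem_nhds (Iio_mem_nhds zero_lt_one)
      filter_upwards [h1, self_mem_nhdsWithin] with ε hε1 hε
      exact hLreal ε hε hε1
    have h1L : (1 : ℝ) ≤ L := ge_of_tendsto hlim hev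
    calc (1 : ℝ≥0∞) = ENNReal.ofReal 1 := ENNReal.ofReal_one.symm
      _ ≤ ENNReal.ofReal L := ENNReal.ofReal_le_ofReal h1L
      _ = gaussianEntropy n (g '' U) := ENNReal.ofReal_toReal htop

end LowerBound

/-! ### Manifolds: `1 ≤ λ(f(M))` -/

section Manifold

variable {EM : Type*} [NormedAddCommGroup EM] [NormedSpace ℝ EM] [FiniteDimensional ℝ EM]
  {H : Type*} [TopologicalSpace H] {I : ModelWithCorners ℝ EM H} [I.Boundaryless]
  {M : Type*} [TopologicalSpace M] [ChartedSpace H M]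
  {F : Type*} [NormedAddCommGroup F] [InnerProductSpace ℝ F] [MeasurableSpace F] [BorelSpace F]

/-- **The entropy of the image of a manifold under a map which is a `C¹` immersion at one point
is at least `1`**: if `f : M → F` (`M` modelled by a boundaryless model on an `n`-dimensional
space, `F` a real inner product space) is `C¹` at `x₀` with injective `mfderiv` there, then
`1 ≤ gaussianEntropy n (range f)`. In particular `1 ≤ λ(ι(M))` for every closed immersed
submanifold, complementing `gaussianEntropy_range_lt_top` (Colding–Minicozzi 2012,
Lemma 7.2 (3)–(4)). [cite: ColdingMinicozzi2012, Lemma 7.2] -/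
theorem one_le_gaussianEntropy_range {n : ℕ} (hn : finrank ℝ EM = n) {f : M → F} (x₀ : M)
    (hf : ContMDiffAt I 𝓘(ℝ, F) 1 f x₀) (hd : Injective (mfderiv I 𝓘(ℝ, F) f x₀)) :
    1 ≤ gaussianEntropy n (range f) := by
  set φ := extChartAt I x₀ with hφ
  set g : EM → F := f ∘ φ.symm with hg
  have hgd : ContDiffAt ℝ 1 g (φ x₀) := by
    have h := (contMDiffAt_iff.1 hf).2
    rw [I.range_eq_univ, contDiffWithinAt_univ] at h
    exact h
  have hmd : MDifferentiableAt I 𝓘(ℝ, F) f x₀ := hf.mdifferentiableAt one_ne_zero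
  have hinj : Injective (fderiv ℝ g (φ x₀)) := by
    have h := hd
    rw [hmd.mfderiv, I.range_eq_univ, fderivWithin_univ] at h
    exact h
  have h1 := one_le_gaussianEntropy_image_of_hasStrictFDerivAt hn
    (hgd.hasStrictFDerivAt one_ne_zero) hinj univ_mem
  refine h1.trans (gaussianEntropy_mono n ?_)
  rintro _ ⟨u, -, rfl⟩
  exact ⟨φ.symm u, rfl⟩

/-- **`1 ≤ λ(f(M)) < ∞` for a closed immersed submanifold**: `M` compact, `f` `C^m` (`m ≥ 1`)
with everywhere injective differential (Colding–Minicozzi 2012, Lemma 7.2 (3)–(4)).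
[cite: ColdingMinicozzi2012, Lemma 7.2] -/
theorem one_le_gaussianEntropy_range_and_lt_top [CompactSpace M] [Nonempty M] {n : ℕ}
    (hn : finrank ℝ EM = n) {f : M → F} {m : WithTop ℕ∞} (hf : ContMDiff I 𝓘(ℝ, F) m f)
    (hm : 1 ≤ m) (hd : ∀ x, Injective (mfderiv I 𝓘(ℝ, F) f x)) :
    1 ≤ gaussianEntropy n (range f) ∧ gaussianEntropy n (range f) < ∞ :=
  ⟨one_le_gaussianEntropy_range hn (Classical.arbitrary M) (hf.of_le hm).contMDiffAt
      (hd _),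
    gaussianEntropy_range_lt_top_of_contMDiff hn hf hm hd⟩

end Manifold

end Literature.Geometry.Riemannian

end
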